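import Literature.IUT.HodgeArakelov.LabelClassesOfCuspsCor24iGraphLevelsOfSpecialFibreComap
import Literature.IUT.HodgeArakelov.LabelClassesOfCuspsCor24iGenuine
import Literature.IUT.HodgeArakelov.PlusMinusTowerCoverModelTempered
import Literature.IUT.HodgeArakelov.StableCurveAgreementPiDictionaryGenuine
import HarnessLib

/-!
# [IUTchII] Cor 2.4 (i)′ AT THE GENUINE PAIR — (B) over an admissible tower, no `eHat`-phrased hypothesis: the node's residual as NAMED L5 data

S. Mochizuki, *Inter-universal Teichmüller Theory II*, kurims manuscript (Dec. 2020), §2, Cor 2.4 (i) pp. 69–71 (proof p. 70 l. −5 – p. 71 l. 5);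
*… I* (May 2020), §2, Cor 2.3 (iii)–(vi) pp. 47–48, Prop 2.4 (i) p. 50 [cite: Mochizuki2012, II Cor 2.4 (i) pp.69–71] (D-0012 claim key, status
DISPUTED: every [IUTchI]/[IUTchII]/[SemiAnbd] statement below is a HYPOTHESIS named by the tree's typed predicates or a kernel theorem about the
tree's own constructions; nothing printed is asserted).

abc-iut cell, node **IUTchII:Cor2.4(i)** (CONE-BOARD claimant abc-iut-w4-d012; gen 6, part 7), GAP-LEDGER G-w4d012-1 / G-w4d012-2.  PROOF-ONLY.
The assembly of this lineage's parts 2 (p437345), 3 (p438582), 6 (`cor24_i_ofSpecialFibre_graphTower_comap`) with abc-iut-w5-d132's genuine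
`Π_v ⊴ Π^±_v`-of-index-`l` lemmas (`range_incl_normal_ofUnderline`, `index_range_incl_ne_zero_ofUnderline`, p437935) — the analogue of
abc-iut-w5-d132's `cor24_i'_ofPiCHat_ofSpecialFibre_comap` (p438532) with the open-subgroup step (B) no longer a tower-side binder `h23vi` but
REDUCED to named data of the sub-graph datum:

* **`cor24_i'_ofPiCHat_of_graphTower_comap`** — at abc-iut-L6-t19's tower of record `ofPiCHat` and abc-iut-L5's datum `ofSpecialFibre` of
  `X̲_v` (B15; binders of p433029 verbatim) there are the transported cuspidal datum `Cu` and a BICONTINUOUS agreement `A`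
  (`eHat ∘ emb = ιX ∘ plainIso`, level clause) such that `Cor24_i' Dec (ofPiCHat …) Cu Ld I` HOLDS for every labelled decomposition `Ld`
  and every `I ⊆ Δ̂^cor_v`, MODULO ONLY: [IUTchI] Prop 2.4 (i) of `X̲_v`'s datum; and, for each admissible `Π_{v□}`, a sub-graph
  `Π^tp_{ℍ'}` of the special fibre of `X̲_v` (`Π̂_{ℍ'}` its closure) with **`Π_{v□} = incl⁻¹(plainIso⁻¹ Π^tp_{X̲_v,ℍ'})`** (the MERGE
  identification «`ℍ = Γ_□`», print p. 70), [IUTchI] Cor 2.3 (iii), (iv), (v) of the `ℍ'`-datum under its `Cor23Hyp` (L5 nodes BY NAME), an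
  ADMISSIBLE tower of the `ℍ'`-datum (levels `ρ̂⁻¹(V_i)`, `V_i ⊴ Π̂_𝔾` open, shrinking to `1`) realised by coverings of semi-graphs
  (abc-iut-w4-d076 `CoveringLevelGraphs`) whose level data satisfy [IUTchI] Cor 2.3 (vi) BY NAME (L5 node; plan/L5/SUBDAG-IUTchI-Cor23Levels.md),
  the (D3) stabiliser statement ([SemiAnbd] Cor 2.7 (i) proof), and `Ĵ_i ⊆` closure of `ιX(plainIso(Π_v))` («levels below `Π̂_{X̲̲_v}`»).
  NO tower-side binder remains besides `hZ`, `hN`, `hDopen` and the special-fibre DATA of `X̲_v`.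

HONEST LABEL: genuine on both sides modulo those binders; the per-`□` residual is a list of NAMED L3/L5 statements about the special fibre of `X̲_v`;
typed ≠ proved for them; nothing here takes a side on [IUTchIII] Cor 3.12 or asserts anything of the series.
-/

noncomputable section

namespace Literature.IUT.HodgeArakelov

open Literature.AnabelianGeometry.EtaleTheta Literature.AnabelianGeometry.SemiGraphs Literature.IUT.HodgeTheaters
open _root_.Topology
open scoped Pointwise

namespace PlusMinusTower

variable {p : ℕ} [Fact p.Prime] {M : MuTwoSetting p} (e : M.CLevelData)
  {E : M.toThetaSetting.EtaleThetaData} {l : ℕ} (C : E.DoubleUnderline l) {N : ℕ+}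
  (μ : M.toThetaSetting.CyclotomeMod l N) (hC : M.toThetaSetting.Compat) (hS : M.toThetaSetting.Sec2Hyps)
  (hl : l.Prime) (hp2 : p ≠ 2) (hpl : p ≠ l) (hζ : ∃ ζ : M.toThetaSetting.K, IsPrimitiveRoot ζ (4 * l))
  {η : (C.thetaEnvData μ hC hS).PiYdd → MuN p N} (hη : η ∈ (C.thetaEnvData μ hC hS).thetaCocycles)
  (hZ : Thm16Sub.KerToZIsCompactlyGenerated M.toThetaSetting) (hN : (C.Huu.subgroupOf (M.GtpXu l)).Normal)
  {P : TopGroup.{0}} (T : TemperedCoverings (BadPlaceSetting.ofUnderline C μ hC hS hl hp2 hpl hζ hη) P)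

/-- `Π̂_v = cl Π_v` as SETS for the tower of record (abc-iut-L6-t19 `ofPiCHat_piPM_piV_deltaCorHat`). ([IUTchII] Def 2.3 (i), kurims p.67)
[claim: Mochizuki2012, status: disputed] -/
theorem coe_hat_ofPiCHat_eq_closure :
    ((ofPiCHat e C μ hC hS hl hp2 hpl hζ hη hZ hN T).hat : Set (ofPiCHat e C μ hC hS hl hp2 hpl hζ hη hZ hN T).Corhat) = closure ((ofPiCHat e C μ hC hS hl hp2 hpl hζ hη hZ hN T).piV : Set (ofPiCHat e C μ hC hS hl hp2 hpl hζ hη hZ hN T).Corhat) := by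
  rw [(ofPiCHat_piPM_piV_deltaCorHat e C μ hC hS hl hp2 hpl hζ hη hZ hN T).2.2.2.2, Subgroup.topologicalClosure_coe]

/-- **[IUTchII] Cor 2.4 (i)′ AT THE GENUINE PAIR, (B) over an admissible tower, dictionary and «levels below `Π̂_v`» intrinsic** (kurims pp. 69–71):
see the module docstring.  PROVED (parts 2, 3, 6 + abc-iut-w5-d132's `range_incl_normal_ofUnderline` / `index_range_incl_ne_zero_ofUnderline`).
([IUTchII] Cor 2.4 (i), kurims pp.69–71) [claim: Mochizuki2012, status: disputed] -/
theorem cor24_i'_ofPiCHat_of_graphTower_comap [(M.GtpXu l).FiniteIndex] [FiniteDimensional ℚ_[p] M.K]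
    (hDopen : ∀ (x : M.toTemperedCurve.Pt) (g : M.toTemperedCurve.PiTemp),
      IsOpen (M.toTemperedCurve.aug '' ((M.toTemperedCurve.decompOfOpenAt (M.GtpXu l) x g).map (M.GtpXu l).subtype :
        Set M.toTemperedCurve.PiTemp)))
    (d : (M.toTemperedCurve.ofOpenSubgroup (M.GtpXu l) (M.toThetaSetting.isOpen_GtpXu l) M.K (range_aug_GtpXu_eq_GK C) hDopen).GroupLevelData)
    (Sf : SpecialFibreData ((M.toTemperedCurve.ofOpenSubgroup (M.GtpXu l) (M.toThetaSetting.isOpen_GtpXu l) M.K (range_aug_GtpXu_eq_GK C) hDopen).toTemperedArithmeticGroup d))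
    (h36 : Sf.Gc.Prop36Hypotheses) (Sigma SigmaHat : Set ℕ) (hsub : Sigma ⊆ SigmaHat) (hne : Sigma.Nonempty)
    (hprime : ∀ q ∈ SigmaHat, q.Prime) (hp : p ∉ Sigma) (TpH : Subgroup Sf.chart.G)
    (HatH : Subgroup (TemperedGraphGroupData.exists_completion_of_prop36 Sf.Gc h36 Sf.chart).choose)
    (hle : TpH.map (TemperedGraphGroupData.exists_completion_of_prop36 Sf.Gc h36 Sf.chart).choose_spec.choose.toMonoidHom ≤ HatH)
    (cuspMeetsH : {x : (M.toTemperedCurve.ofOpenSubgroup (M.GtpXu l) (M.toThetaSetting.isOpen_GtpXu l) M.K (range_aug_GtpXu_eq_GK C) hDopen).Pt // (M.toTemperedCurve.ofOpenSubgroup (M.GtpXu l) (M.toThetaSetting.isOpen_GtpXu l) M.K (range_aug_GtpXu_eq_GK C) hDopen).IsCusp x} → Prop)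
    {D : EtaleThetaData (BadPlaceSetting.ofUnderline C μ hC hS hl hp2 hpl hζ hη).toThetaSetting P}
    (Dec : SubgraphDecomposition (BadPlaceSetting.ofUnderline C μ hC hS hl hp2 hpl hζ hη) T D) :
    ∃ (Cu : CuspidalInertiaData (ofPiCHat e C μ hC hS hl hp2 hpl hζ hη hZ hN T))
      (A : StableCurveAgreement (ofPiCHat e C μ hC hS hl hp2 hpl hζ hη hZ hN T) Cu
        (StableCurveTemperedData.ofSpecialFibre (M.toTemperedCurve.ofOpenSubgroup (M.GtpXu l) (M.toThetaSetting.isOpen_GtpXu l) M.K (range_aug_GtpXu_eq_GK C) hDopen) d Sf h36 Sigma SigmaHat hsub hne hprime hp TpH HatH hle cuspMeetsH)),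
      IsHomeomorph A.eHat ∧
      (∀ x : T.Xplain,
        A.eHat ⟨(ofPiCHat e C μ hC hS hl hp2 hpl hζ hη hZ hN T).emb x, (ofPiCHat e C μ hC hS hl hp2 hpl hζ hη hZ hN T).emb_le_pmHat ⟨x, rfl⟩⟩ =
          (StableCurveTemperedData.ofSpecialFibre (M.toTemperedCurve.ofOpenSubgroup (M.GtpXu l) (M.toThetaSetting.isOpen_GtpXu l) M.K (range_aug_GtpXu_eq_GK C) hDopen) d Sf h36 Sigma SigmaHat hsub hne hprime hp TpH HatH hle cuspMeetsH).ιX (T.plainIso x)) ∧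
      (∀ (Q I : Subgroup (ofPiCHat e C μ hC hS hl hp2 hpl hζ hη hZ hN T).Corhat), Cu.IsCuspidalInertia Q I ↔
        I ≤ Q ∧ ∃ I₀, Cu.IsCuspidalInertia (ofPiCHat e C μ hC hS hl hp2 hpl hζ hη hZ hN T).piPM I₀ ∧ I = I₀ ⊓ Q) ∧
      ∀ {L : LabCuspStructure Cu} (Ld : LabelledDecomposition Dec L),
        (StableCurveTemperedData.ofSpecialFibre (M.toTemperedCurve.ofOpenSubgroup (M.GtpXu l) (M.toThetaSetting.isOpen_GtpXu l) M.K (range_aug_GtpXu_eq_GK C) hDopen) d Sf h36 Sigma SigmaHat hsub hne hprime hp TpH HatH hle cuspMeetsH).Prop24i →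
        ∀ {I : Subgroup (ofPiCHat e C μ hC hS hl hp2 hpl hζ hη hZ hN T).Corhat},
          (∀ H : Subgroup P, Cor24_family Dec Ld H →
            ∃ (TpH' : Subgroup Sf.chart.G) (HatH' : Subgroup (TemperedGraphGroupData.exists_completion_of_prop36 Sf.Gc h36 Sf.chart).choose)
              (hle' : TpH'.map (TemperedGraphGroupData.exists_completion_of_prop36 Sf.Gc h36 Sf.chart).choose_spec.choose.toMonoidHom ≤ HatH')
              (cMH' : {x : (M.toTemperedCurve.ofOpenSubgroup (M.GtpXu l) (M.toThetaSetting.isOpen_GtpXu l) M.K (range_aug_GtpXu_eq_GK C) hDopen).Pt // (M.toTemperedCurve.ofOpenSubgroup (M.GtpXu l) (M.toThetaSetting.isOpen_GtpXu l) M.K (range_aug_GtpXu_eq_GK C) hDopen).IsCusp x} → Prop)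
              (_ : ((StableCurveTemperedData.ofSpecialFibre (M.toTemperedCurve.ofOpenSubgroup (M.GtpXu l) (M.toThetaSetting.isOpen_GtpXu l) M.K (range_aug_GtpXu_eq_GK C) hDopen) d Sf h36 Sigma SigmaHat hsub hne hprime hp TpH' HatH' hle' cMH').graph.HatH :
                  Set (StableCurveTemperedData.ofSpecialFibre (M.toTemperedCurve.ofOpenSubgroup (M.GtpXu l) (M.toThetaSetting.isOpen_GtpXu l) M.K (range_aug_GtpXu_eq_GK C) hDopen) d Sf h36 Sigma SigmaHat hsub hne hprime hp TpH' HatH' hle' cMH').graph.Hat) =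
                closure ((StableCurveTemperedData.ofSpecialFibre (M.toTemperedCurve.ofOpenSubgroup (M.GtpXu l) (M.toThetaSetting.isOpen_GtpXu l) M.K (range_aug_GtpXu_eq_GK C) hDopen) d Sf h36 Sigma SigmaHat hsub hne hprime hp TpH' HatH' hle' cMH').graph.ι ''
                  (StableCurveTemperedData.ofSpecialFibre (M.toTemperedCurve.ofOpenSubgroup (M.GtpXu l) (M.toThetaSetting.isOpen_GtpXu l) M.K (range_aug_GtpXu_eq_GK C) hDopen) d Sf h36 Sigma SigmaHat hsub hne hprime hp TpH' HatH' hle' cMH').graph.TpH))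
              (_ : H = ((StableCurveTemperedData.ofSpecialFibre (M.toTemperedCurve.ofOpenSubgroup (M.GtpXu l) (M.toThetaSetting.isOpen_GtpXu l) M.K (range_aug_GtpXu_eq_GK C) hDopen) d Sf h36 Sigma SigmaHat hsub hne hprime hp TpH' HatH' hle' cMH').piTpXH.comap
                  T.plainIso.toMulEquiv.toMonoidHom).comap T.incl)
              (_ : (StableCurveTemperedData.ofSpecialFibre (M.toTemperedCurve.ofOpenSubgroup (M.GtpXu l) (M.toThetaSetting.isOpen_GtpXu l) M.K (range_aug_GtpXu_eq_GK C) hDopen) d Sf h36 Sigma SigmaHat hsub hne hprime hp TpH' HatH' hle' cMH').Cor23Hyp)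
              (_ : (StableCurveTemperedData.ofSpecialFibre (M.toTemperedCurve.ofOpenSubgroup (M.GtpXu l) (M.toThetaSetting.isOpen_GtpXu l) M.K (range_aug_GtpXu_eq_GK C) hDopen) d Sf h36 Sigma SigmaHat hsub hne hprime hp TpH' HatH' hle' cMH').Cor23iii)
              (_ : (StableCurveTemperedData.ofSpecialFibre (M.toTemperedCurve.ofOpenSubgroup (M.GtpXu l) (M.toThetaSetting.isOpen_GtpXu l) M.K (range_aug_GtpXu_eq_GK C) hDopen) d Sf h36 Sigma SigmaHat hsub hne hprime hp TpH' HatH' hle' cMH').Cor23iv)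
              (_ : (StableCurveTemperedData.ofSpecialFibre (M.toTemperedCurve.ofOpenSubgroup (M.GtpXu l) (M.toThetaSetting.isOpen_GtpXu l) M.K (range_aug_GtpXu_eq_GK C) hDopen) d Sf h36 Sigma SigmaHat hsub hne hprime hp TpH' HatH' hle' cMH').Cor23v)
              (Tw : (StableCurveTemperedData.ofSpecialFibre (M.toTemperedCurve.ofOpenSubgroup (M.GtpXu l) (M.toThetaSetting.isOpen_GtpXu l) M.K (range_aug_GtpXu_eq_GK C) hDopen) d Sf h36 Sigma SigmaHat hsub hne hprime hp TpH' HatH' hle' cMH').Prop24Tower)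
              (V : Tw.I → Subgroup (StableCurveTemperedData.ofSpecialFibre (M.toTemperedCurve.ofOpenSubgroup (M.GtpXu l) (M.toThetaSetting.isOpen_GtpXu l) M.K (range_aug_GtpXu_eq_GK C) hDopen) d Sf h36 Sigma SigmaHat hsub hne hprime hp TpH' HatH' hle' cMH').graph.Hat)
              (_ : ∀ i (y : (StableCurveTemperedData.ofSpecialFibre (M.toTemperedCurve.ofOpenSubgroup (M.GtpXu l) (M.toThetaSetting.isOpen_GtpXu l) M.K (range_aug_GtpXu_eq_GK C) hDopen) d Sf h36 Sigma SigmaHat hsub hne hprime hp TpH' HatH' hle' cMH').DeltaHat),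
                (y : (StableCurveTemperedData.ofSpecialFibre (M.toTemperedCurve.ofOpenSubgroup (M.GtpXu l) (M.toThetaSetting.isOpen_GtpXu l) M.K (range_aug_GtpXu_eq_GK C) hDopen) d Sf h36 Sigma SigmaHat hsub hne hprime hp TpH' HatH' hle' cMH').PiHat) ∈ Tw.Jhat i ↔
                  (StableCurveTemperedData.ofSpecialFibre (M.toTemperedCurve.ofOpenSubgroup (M.GtpXu l) (M.toThetaSetting.isOpen_GtpXu l) M.K (range_aug_GtpXu_eq_GK C) hDopen) d Sf h36 Sigma SigmaHat hsub hne hprime hp TpH' HatH' hle' cMH').ρHat y ∈ V i)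
              (_ : ∀ i, (V i).Normal) (_ : ∀ i, IsOpen (V i : Set (StableCurveTemperedData.ofSpecialFibre (M.toTemperedCurve.ofOpenSubgroup (M.GtpXu l) (M.toThetaSetting.isOpen_GtpXu l) M.K (range_aug_GtpXu_eq_GK C) hDopen) d Sf h36 Sigma SigmaHat hsub hne hprime hp TpH' HatH' hle' cMH').graph.Hat))
              (_ : ∀ O ∈ 𝓝 (1 : (StableCurveTemperedData.ofSpecialFibre (M.toTemperedCurve.ofOpenSubgroup (M.GtpXu l) (M.toThetaSetting.isOpen_GtpXu l) M.K (range_aug_GtpXu_eq_GK C) hDopen) d Sf h36 Sigma SigmaHat hsub hne hprime hp TpH' HatH' hle' cMH').graph.Hat), ∃ i, (V i : Set _) ⊆ O)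
              (Cv : Tw.CoveringLevelGraphs) (Ad : ∀ i, Cv.toLevelData.LevelDatum i),
              (∀ i, (Ad i).lev.Cor23vi) ∧
              (∀ i (γ : (StableCurveTemperedData.ofSpecialFibre (M.toTemperedCurve.ofOpenSubgroup (M.GtpXu l) (M.toThetaSetting.isOpen_GtpXu l) M.K (range_aug_GtpXu_eq_GK C) hDopen) d Sf h36 Sigma SigmaHat hsub hne hprime hp TpH' HatH' hle' cMH').DeltaTp),
                (∀ v ∈ Cv.toLevelData.compH i, Cv.toLevelData.act i
                  (γ : (StableCurveTemperedData.ofSpecialFibre (M.toTemperedCurve.ofOpenSubgroup (M.GtpXu l) (M.toThetaSetting.isOpen_GtpXu l) M.K (range_aug_GtpXu_eq_GK C) hDopen) d Sf h36 Sigma SigmaHat hsub hne hprime hp TpH' HatH' hle' cMH').PiTp) v ∈ Cv.toLevelData.compH i) →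
                  ∃ ĥ ∈ (StableCurveTemperedData.ofSpecialFibre (M.toTemperedCurve.ofOpenSubgroup (M.GtpXu l) (M.toThetaSetting.isOpen_GtpXu l) M.K (range_aug_GtpXu_eq_GK C) hDopen) d Sf h36 Sigma SigmaHat hsub hne hprime hp TpH' HatH' hle' cMH').graph.HatH,
                    ĥ⁻¹ * (StableCurveTemperedData.ofSpecialFibre (M.toTemperedCurve.ofOpenSubgroup (M.GtpXu l) (M.toThetaSetting.isOpen_GtpXu l) M.K (range_aug_GtpXu_eq_GK C) hDopen) d Sf h36 Sigma SigmaHat hsub hne hprime hp TpH' HatH' hle' cMH').graph.ι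
                      ((StableCurveTemperedData.ofSpecialFibre (M.toTemperedCurve.ofOpenSubgroup (M.GtpXu l) (M.toThetaSetting.isOpen_GtpXu l) M.K (range_aug_GtpXu_eq_GK C) hDopen) d Sf h36 Sigma SigmaHat hsub hne hprime hp TpH' HatH' hle' cMH').ρTp γ) ∈ V i) ∧
              (∀ i, (Tw.Jhat i : Set (StableCurveTemperedData.ofSpecialFibre (M.toTemperedCurve.ofOpenSubgroup (M.GtpXu l) (M.toThetaSetting.isOpen_GtpXu l) M.K (range_aug_GtpXu_eq_GK C) hDopen) d Sf h36 Sigma SigmaHat hsub hne hprime hp TpH' HatH' hle' cMH').PiHat) ⊆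
                closure (((T.incl.range.map T.plainIso.toMulEquiv.toMonoidHom).map
                  (StableCurveTemperedData.ofSpecialFibre (M.toTemperedCurve.ofOpenSubgroup (M.GtpXu l) (M.toThetaSetting.isOpen_GtpXu l) M.K (range_aug_GtpXu_eq_GK C) hDopen) d Sf h36 Sigma SigmaHat hsub hne hprime hp TpH HatH hle cuspMeetsH).ιX : Subgroup _) : Set _))) →
          Literature.IUT.HodgeArakelov.Cor24_i' Dec (ofPiCHat e C μ hC hS hl hp2 hpl hζ hη hZ hN T) Cu Ld I := by
  obtain ⟨Cu, A, hhomeo, hA, hlev⟩ := exists_stableCurveAgreement_ofPiCHat_ofSpecialFibre_isHomeomorph e C μ hC hS hl hp2 hpl hζ hη hZ hN T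
    hDopen d Sf h36 Sigma SigmaHat hsub hne hprime hp TpH HatH hle cuspMeetsH
  refine ⟨Cu, A, hhomeo, hA, hlev, fun Ld h24i I GraphTower H hH => ?_⟩
  obtain ⟨TpH', HatH', hle', cMH', hH', hHeq, hHyp', h23iii', h23iv', h23v', Tw, V, hJhat, hVn, hVo, hV, Cv, Ad, h23vi, hst, hJ⟩ :=
    GraphTower H hH
  rw [hHeq]
  exact A.cor24_i_ofSpecialFibre_graphTower_comap hlev (piPM_inf_hat_le_piV_ofPiCHat e C μ hC hS hl hp2 hpl hζ hη hZ hN T).2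
    (coe_hat_ofPiCHat_eq_closure e C μ hC hS hl hp2 hpl hζ hη hZ hN T) hhomeo T.plainIso.toMulEquiv hA
    (range_incl_normal_ofUnderline C μ hC hS hl hp2 hpl hζ hη hN T) (index_range_incl_ne_zero_ofUnderline C μ hC hS hl hp2 hpl hζ hη T)
    h24i I TpH' HatH' hle' cMH' hH' hHyp' h23iii' h23iv' h23v' Tw V hJhat hVn hVo hV Cv Ad h23vi hst hJ

end PlusMinusTower

end Literature.IUT.HodgeArakelov

end
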